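import Literature.NumberTheory.Sieve.LargestPrimeFactorCubicLnuSeries
import Literature.NumberTheory.Sieve.LargestPrimeFactorCubicCCondCount
import HarnessLib

/-!
# Heath-Brown 2001 (PLMS), (2.18)–(2.19): `h(q) = ∑_{d∣q} l(d)` — `h(q) = f(q) ∏_{p∣q}(1 − g(p)/p)⁻¹` on `𝒬`, `0` off `𝒬`

Topic `Literature/NumberTheory/Sieve`; a PROVED arithmetic layer (one definition with body, no named
facts) under the named fact `Irving2015_largestPrimeFactor_cubic` (`LargestPrimeFactorCubic.lean`),
continuing `…LnuSeries` (`lFun = l`).  Source: D. R. Heath-Brown, *The largest prime factor of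
`X³ + 2`*, Proc. London Math. Soc. (3) 82 (2001) 554–596: p. 10 defines the multiplicative function
`l` at prime powers ((2.18)–(2.19)) and on p. 27 uses "In view of the definition of `h(q)` we may
include an extra summation condition `(a, b) = 1` in (2.20). Moreover, we have `h(q) = ∑_{d∣q} l(d)`";
`h` enters the main term through §6 (p. 23): "`f(q)σ₂(q) ≥ 2{C₀ + o(1)} f(q) ∏_{p∣q}(1 − g(p)/p)⁻¹
∏_{p<X^δ}(1 − g(p)/p) = 2{C₀ + o(1)} h(q) ∏_{p<X^δ}(1 − g(p)/p)`", i.e. `h(q) = f(q)∏_{p∣q}(1 −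
g(p)/p)⁻¹` for `q ∈ 𝒬` (square-free, coprime to `6`), `f(q) = ∏_{p∣q}(1 − 2/p)`.

PROVED here, with `hFun := lFun * ζ` (so `hFun q = ∑_{d∣q} l(d)` by definition of the Dirichlet
product): `hFun_apply_eq_sum`, `isMultiplicative_hFun`, the prime-power values `hFun_prime`
(`= (p − 2)/(p − g(p))`, `p ≥ 5`), `hFun_prime_pow_eq_zero` (`a ≥ 2`, `p ≥ 5`), `hFun_two_pow`,
`hFun_three_pow` (`= 0`), and

* **`hFun_eq_of_mem_Q`** — `hFun q = f(q) ∏_{p∣q} (1 − g(p)/p)⁻¹` for `q` square-free and coprime to `6`;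
* **`hFun_eq_zero_of_not`** — `hFun q = 0` if `q ≠ 0` is not square-free or not coprime to `6`.

## References

* D. R. Heath-Brown, *The largest prime factor of `X³ + 2`*, Proc. London Math. Soc. (3) 82 (2001)
  554–596, (2.18)–(2.19) p. 10, §6 p. 23, §7 p. 27. [`HeathBrown2001LargestPrimeFactorCubic`]

## Mathlib / tree search

Tree: `lFun`, `lFun_prime_pow`, `lpp`, `isMultiplicative_lFun`, `lOne`, `lTwo` (`…LnuSeries`,
`…EulerIdentity`), `fq` (`…CCondCount`), `cubeRootTwoCount_mem` (`…Splitting`),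
`CubicPrimes.cubeRootTwoCount_two/three`.  Mathlib: `ArithmeticFunction.coe_mul_zeta_apply`,
`ArithmeticFunction.isMultiplicative_zeta`, `IsMultiplicative.mul`, `Nat.divisors_prime_pow`,
`IsMultiplicative.multiplicative_factorization`.
-/

noncomputable section

open Finset ArithmeticFunction
open scoped ArithmeticFunction.zeta

namespace Literature.NumberTheory.Sieve.HeathBrown2001

open CubicPrimes (cubeRootTwoCount)

/-- Heath-Brown's `h = l * 1`: `hFun q = ∑_{d∣q} l(d)`. [cite: HeathBrown2001LargestPrimeFactorCubic, §7 p. 27 ("h(q) = Σ_{d|q} l(d)")] -/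
def hFun : ArithmeticFunction ℝ := lFun * ζ

/-- `hFun q = ∑_{d∣q} l(d)`. [folklore] -/
theorem hFun_apply_eq_sum (q : ℕ) : hFun q = ∑ d ∈ q.divisors, lFun d := by
  rw [hFun, coe_mul_zeta_apply]

/-- `h` is multiplicative. [folklore] -/
theorem isMultiplicative_hFun : hFun.IsMultiplicative :=
  isMultiplicative_lFun.mul isMultiplicative_zeta.natCast

/-- `h` at a prime power: `h(p^a) = ∑_{e ≤ a} l(p^e)`. [folklore] -/
theorem hFun_prime_pow {p : ℕ} (hp : p.Prime) (a : ℕ) :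
    hFun (p ^ a) = ∑ e ∈ Finset.range (a + 1), lpp p e := by
  rw [hFun_apply_eq_sum, Nat.divisors_prime_pow hp, Finset.sum_map]
  refine Finset.sum_congr rfl fun e _ => ?_
  simp only [Function.Embedding.coeFn_mk]
  rcases Nat.eq_zero_or_pos e with rfl | he
  · rw [pow_zero, isMultiplicative_lFun.map_one, lpp, if_pos rfl]
  · rw [lFun_prime_pow hp he.ne']

/-- `h(p) = 1 + l(p) = (p − 2)/(p − g(p))` for a prime `p ≥ 5`.
[cite: HeathBrown2001LargestPrimeFactorCubic, (2.18)] -/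
theorem hFun_prime {p : ℕ} (hp : p.Prime) (h5 : 5 ≤ p) :
    hFun p = ((p : ℝ) - 2) / ((p : ℝ) - cubeRootTwoCount p) := by
  have hp3 : p ≠ 3 := by omega
  have hp5 : (5 : ℝ) ≤ p := by exact_mod_cast h5
  have hg3 : (cubeRootTwoCount p : ℝ) ≤ 3 := by
    rcases cubeRootTwoCount_mem hp h5 with h | h | h <;> simp [h]
  have hden : (p : ℝ) - cubeRootTwoCount p ≠ 0 := by linarith
  have := hFun_prime_pow hp 1
  rw [pow_one] at this
  rw [this, Finset.sum_range_succ, Finset.sum_range_one, lpp, lpp, if_pos rfl, if_neg one_ne_zero, if_pos rfl,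
    lOne, if_neg hp3]
  field_simp
  ring

/-- `h(p^a) = 1 + l(p) + l(p²) = 0` for a prime `p ≥ 5` and `a ≥ 2` (`h` detects square-freeness).
[cite: HeathBrown2001LargestPrimeFactorCubic, (2.18)] -/
theorem hFun_prime_pow_eq_zero {p : ℕ} (hp : p.Prime) (h5 : 5 ≤ p) {a : ℕ} (ha : 2 ≤ a) : hFun (p ^ a) = 0 := by
  have hp3 : p ≠ 3 := by omega
  have hp5 : (5 : ℝ) ≤ p := by exact_mod_cast h5
  have hg3 : (cubeRootTwoCount p : ℝ) ≤ 3 := by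
    rcases cubeRootTwoCount_mem hp h5 with h | h | h <;> simp [h]
  have hden : (p : ℝ) - cubeRootTwoCount p ≠ 0 := by linarith
  rw [hFun_prime_pow hp a]
  -- the terms `e ≥ 3` vanish; the first three sum to `0`
  have hsplit : ∑ e ∈ Finset.range (a + 1), lpp p e = ∑ e ∈ Finset.range 3, lpp p e := by
    obtain ⟨t, ht⟩ : ∃ t, a + 1 = 3 + t := ⟨a + 1 - 3, by omega⟩
    rw [ht, Finset.sum_range_add]
    have : ∑ x ∈ Finset.range t, lpp p (3 + x) = 0 :=
      Finset.sum_eq_zero fun x _ => by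
        rw [lpp, if_neg (by omega), if_neg (by omega), if_neg (by omega)]
    rw [this, add_zero]
  rw [hsplit, Finset.sum_range_succ, Finset.sum_range_succ, Finset.sum_range_one, lpp, lpp, lpp,
    if_pos rfl, if_neg one_ne_zero, if_pos rfl, if_neg two_ne_zero, if_neg (by norm_num), if_pos rfl,
    lOne, lTwo, if_neg hp3, if_neg hp3]
  field_simp
  ring

/-- `h(2^a) = 0` for `a ≥ 1` (`l(2) = −1`, `l(4) = 0`). [cite: HeathBrown2001LargestPrimeFactorCubic, (2.18) (g(2) = 1)] -/
theorem hFun_two_pow {a : ℕ} (ha : 1 ≤ a) : hFun (2 ^ a) = 0 := by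
  rw [hFun_prime_pow Nat.prime_two a]
  obtain ⟨t, ht⟩ : ∃ t, a + 1 = 2 + t := ⟨a + 1 - 2, by omega⟩
  rw [ht, Finset.sum_range_add]
  have h0 : ∑ x ∈ Finset.range t, lpp 2 (2 + x) = 0 :=
    Finset.sum_eq_zero fun x _ => by
      rw [lpp, if_neg (by omega), if_neg (by omega)]
      split_ifs with h2
      · rw [lTwo, if_neg (by norm_num), CubicPrimes.cubeRootTwoCount_two]; norm_num
      · rfl
  rw [h0, add_zero, Finset.sum_range_succ, Finset.sum_range_one, lpp, lpp, if_pos rfl, if_neg one_ne_zero,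
    if_pos rfl, lOne, if_neg (by norm_num), CubicPrimes.cubeRootTwoCount_two]
  norm_num

/-- `h(3^a) = 0` for `a ≥ 1` (`l(3) = −1`, `l(9) = 0`). [cite: HeathBrown2001LargestPrimeFactorCubic, (2.19)] -/
theorem hFun_three_pow {a : ℕ} (ha : 1 ≤ a) : hFun (3 ^ a) = 0 := by
  rw [hFun_prime_pow Nat.prime_three a]
  obtain ⟨t, ht⟩ : ∃ t, a + 1 = 2 + t := ⟨a + 1 - 2, by omega⟩
  rw [ht, Finset.sum_range_add]
  have h0 : ∑ x ∈ Finset.range t, lpp 3 (2 + x) = 0 :=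
    Finset.sum_eq_zero fun x _ => by
      rw [lpp, if_neg (by omega), if_neg (by omega)]
      split_ifs with h2
      · rw [lTwo, if_pos rfl]
      · rfl
  rw [h0, add_zero, Finset.sum_range_succ, Finset.sum_range_one, lpp, lpp, if_pos rfl, if_neg one_ne_zero,
    if_pos rfl, lOne, if_pos rfl]
  norm_num

/-! ### `h` on and off `𝒬` -/

/-- **`h(q) = f(q) ∏_{p∣q} (1 − g(p)/p)⁻¹`** for `q` square-free and coprime to `6`.
[cite: HeathBrown2001LargestPrimeFactorCubic, §6 p. 23 and (2.18)] -/
theorem hFun_eq_of_mem_Q {q : ℕ} (hsq : Squarefree q) (h6 : q.Coprime 6) :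
    hFun q = fq q * ∏ p ∈ q.primeFactors, (1 - (cubeRootTwoCount p : ℝ) / p)⁻¹ := by
  have hq0 : q ≠ 0 := hsq.ne_zero
  rw [isMultiplicative_hFun.multiplicative_factorization hFun hq0, Finsupp.prod, Nat.support_factorization, fq,
    ← Finset.prod_mul_distrib]
  refine Finset.prod_congr rfl fun p hp => ?_
  have hpP := Nat.prime_of_mem_primeFactors hp
  have hpq := Nat.dvd_of_mem_primeFactors hp
  have hfac : q.factorization p = 1 :=
    le_antisymm (hsq.natFactorization_le_one p) (hpP.factorization_pos_of_dvd hq0 hpq)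
  -- `p ≥ 5` since `(q, 6) = 1`
  have h5 : 5 ≤ p := by
    have h2 : p ≠ 2 := fun h => by
      have : 2 ∣ Nat.gcd q 6 := Nat.dvd_gcd (h ▸ hpq) (by norm_num)
      rw [h6] at this; omega
    have h3 : p ≠ 3 := fun h => by
      have : 3 ∣ Nat.gcd q 6 := Nat.dvd_gcd (h ▸ hpq) (by norm_num)
      rw [h6] at this; omega
    have := hpP.two_le
    by_contra hlt
    interval_cases p <;> first | omega | exact absurd hpP (by decide)
  rw [hfac, pow_one, hFun_prime hpP h5]
  have hp5 : (5 : ℝ) ≤ p := by exact_mod_cast h5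
  have hg3 : (cubeRootTwoCount p : ℝ) ≤ 3 := by
    rcases cubeRootTwoCount_mem hpP h5 with h | h | h <;> simp [h]
  have h1 : (p : ℝ) - cubeRootTwoCount p ≠ 0 := by linarith
  have h2 : (p : ℝ) ≠ 0 := by linarith
  field_simp

/-- **`h(q) = 0`** for `q ≠ 0` not square-free or not coprime to `6`.
[cite: HeathBrown2001LargestPrimeFactorCubic, (2.18)–(2.19)] -/
theorem hFun_eq_zero_of_not {q : ℕ} (hq0 : q ≠ 0) (h : ¬ (Squarefree q ∧ q.Coprime 6)) : hFun q = 0 := by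
  rw [isMultiplicative_hFun.multiplicative_factorization hFun hq0, Finsupp.prod, Nat.support_factorization]
  -- find a prime power factor on which `h` vanishes
  by_cases hsq : Squarefree q
  · -- then `(q, 6) ≠ 1`: `2 ∣ q` or `3 ∣ q`
    have h6 : ¬ q.Coprime 6 := fun h6 => h ⟨hsq, h6⟩
    obtain ⟨p, hp, hpq, hp6⟩ := Nat.Prime.not_coprime_iff_dvd.mp h6
    have hp23 : p = 2 ∨ p = 3 := by
      have h6' : p ∣ 6 := hp6
      have hle := Nat.le_of_dvd (by norm_num) h6'
      have := hp.two_le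
      interval_cases p
      · left; rfl
      · right; rfl
      · exact absurd hp (by decide)
      · exact absurd h6' (by decide)
      · exact absurd hp (by decide)
    have hmem : p ∈ q.primeFactors := Nat.mem_primeFactors.mpr ⟨hp, hpq, hq0⟩
    apply Finset.prod_eq_zero hmem
    have hfac : 1 ≤ q.factorization p := hp.factorization_pos_of_dvd hq0 hpq
    rcases hp23 with rfl | rfl
    · exact hFun_two_pow hfac
    · exact hFun_three_pow hfac
  · -- some `p² ∣ q`
    rw [Nat.squarefree_iff_factorization_le_one hq0] at hsq
    push Not at hsq
    obtain ⟨p, hp2⟩ := hsq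
    have hpmem : p ∈ q.primeFactors := by
      rw [← Nat.support_factorization, Finsupp.mem_support_iff]; omega
    have hp := Nat.prime_of_mem_primeFactors hpmem
    apply Finset.prod_eq_zero hpmem
    rcases Nat.lt_or_ge p 5 with hlt | h5
    · have := hp.two_le
      interval_cases p
      · exact hFun_two_pow (by omega)
      · exact hFun_three_pow (by omega)
      · exact absurd hp (by decide)
    · exact hFun_prime_pow_eq_zero hp h5 (by omega)

end Literature.NumberTheory.Sieve.HeathBrown2001
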